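import Summits.BirchSwinnertonDyer.Rank1Residual.X2.CongruenceTransferForms
import Summits.BirchSwinnertonDyer.Rank1Residual.X2.CongruentLambdaShiftMultiplicative
import Literature.NumberTheory.EllipticCurves.CastellaGrossiSkinner2025.MazurMainConjecture
import HarnessLib

/-!
# Class X2 (odd multiplicative Eisenstein prime): ROUTE G WITH A COVERED PARTNER — Mazur's main
# conjecture / `BSD(E₀, p)` at an X2 pair from a congruent GOOD NON-ANOMALOUS Eisenstein relative,
# whose main conjecture is PUBLISHED (Castella–Grossi–Skinner, Math. Ann. 393 (2025), Theorem A)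
# (cell `b2b-bsdres`, unit `b2b-bsdres-eisenstein-p2`, gen 14)

HONEST FRAMING (run/shared/lean/b2b/bsd-rank1-residual/, verbatim in every file): the goal of the
cell is to DELETE the COMBINATION-SHAPED residual classes of the Birch–Swinnerton-Dyer formula for
ALL analytic-rank `≤ 1` elliptic curves over `ℚ` — "full BSD formula for every rank `≤ 1` curve in
class `C`" assembled STRICTLY from published theorems — so that the rank-`≤ 1` remainder becomes
exactly the CONSTRUCTION-SHAPED classes, which are TYPED (missing-input `Prop`s), NOT attempted.
This is not "finishing BSD". Research route; NO CLAIM BEYOND STATED CLASSES; nothing here changes a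
label; X2b and X2c stay CONSTRUCTION-SHAPED (route G is a per-pair CERTIFICATE route). Theorems only
(no definition, no named fact, nothing asserted): every published theorem enters as one of the
tree's existing NAMED FACTS, taken as a hypothesis.

## What is new in this file

Gen 7's route G (`X2/CongruenceTransferForms.lean`) closes Mazur's main conjecture at an X2 pair
`(E₀, p)` (`p ‖ N₀`, `E₀[p]` reducible, `p` odd) from a congruent relative `E₀'` (`E₀[p] ≅ E₀'[p]`)
whose main conjecture is KNOWN — so far a relative CLOSED BY CERTIFICATE (routes lamMin / P / T, or
an X1-leaf certificate). Here the relative is a GOOD, reducible, NON-ANOMALOUS pair `(E₀', p)`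
(`p ∤ N₀'`, `a_p(E₀') ≢ 1 (mod p)`): for such a pair Mazur's main conjecture is a PUBLISHED THEOREM,
Castella–Grossi–Skinner 2025 Theorem A (tree fact
`CastellaGrossiSkinner2025.thmA_charIdeal_eq_padicLFunction`, cell registry: CGS25 Thm A), whose
conclusion is literally the tree's `MazurMainConjecture E₀' p` (`mazurMainConjecture_of_thmA`).
These relatives lie in the COVERED class C6 of RESIDUAL-CASES §a.1 and were never used as route-G
partners before (gen 7's census joined X2 only with the ANOMALOUS X1 classes).

WHERE SUCH RELATIVES EXIST: if `E₀` has NON-SPLIT multiplicative reduction at `p`, then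
`E₀[p]|_{G_p}` has Jordan–Hölder characters `{ωδ, δ}` with `δ` the unramified quadratic character,
so a good relative `E₀'` (`E₀'[p] ≅ E₀[p]`) is ordinary with `a_p(E₀') ≡ δ(Frob_p) = −1 (mod p)`:
NON-ANOMALOUS, and `φ|_{G_p} ∈ {ωδ, δ} ∌ 1, ω` — exactly CGS's hypothesis. (A split `E₀` has
anomalous good relatives — the X1 leaf, where the main conjecture is the OPEN input.) In the
theorems below the non-anomaly of the relative is a HYPOTHESIS (`hna'`, decided per pair by
`a_p(E₀') mod p`), so they are stated for any multiplicative `E₀`.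

Contents (all at an odd prime `p`):
* §1 `mazurMainConjecture_of_thmA` — CGS Thm. A ⇒ the tree's `MazurMainConjecture W' p` for a good,
  reducible, non-anomalous `(W', p)`, `p > 2` (ordinarity automatic: `goodOrd_of_red_of_good`).
* §2 `algebraicInvariantsEq_of_coveredRelative` — `(μ_alg, λ_alg)(E₀) = (0, n' + e)` from the
  covered relative's analytic certificates `μ_an(E₀') = 0`, `λ_an(E₀') = n'`, the congruence
  `E₀[p] ≅ E₀'[p]` and the shift `CongruentLambdaShift W W' p e` (typed, as in gen 7);
  `…_of_facts` — the same with the shift DERIVED (gen 13,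
  `CongruentLambdaShiftMultiplicative.congruentLambdaShift_mult_goodOrd_of_facts`:
  `e = Σ_{v∈Σ₀}(δ' − δ) − e_p(E₀)`), i.e. from PRINTED statements only.
* §3 headlines: `mazurMainConjectureAt_of_coveredRelative(_of_facts)` (both ranks; X2b's typed
  input `MissingInputB`, X2c's cyclotomic main conjecture), `bsdp_of_coveredRelative_rankZero(_of_facts)`
  (`BSD(E₀, p)` at `r_an = 0`). The NON-SPLIT forms `…_of_not_split` (`e_p(E₀) = 0`, one integer
  inequality) are in the companion file `X2/CongruenceTransferCoveredNonsplit.lean`.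

The remaining per-pair inputs are CERTIFICATES: the analytic invariants of both pairs (two-engine
census columns), the congruence `TorsionIso`, the local data `Σ₀`/`δ`, and one integer inequality.
Census (HOME/b2b-bsdres-eisenstein-p2/covered/, gen 14): of the 254 NON-SPLIT X2 pairs at `p = 3`,
`N < 2·10⁴`, 224 have a covered relative of conductor `< 2·10⁴`.

References: [CastellaGrossiSkinner2025] Thm. A (§0) = Thm. 6.0.5; [GreenbergVatsal2000] Thm. (1.4),
§1 (5)–(7), pp. 14–15, §2 pp. 20–27; [Wuthrich2014] Thm. 16; [SteinWuthrich2013] Thm. 6.1;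
[Serre1972] §1.11 Prop. 12; HOME/b2b-bsdres-eisenstein-p2/X2-GAP.md §19.
-/

set_option autoImplicit false

noncomputable section

open scoped Classical MatrixGroups ModularForm

open PowerSeries CongruenceSubgroup WeierstrassCurve NumberField IsDedekindDomain
  Literature.NumberTheory.EllipticCurves
  Literature.NumberTheory.EllipticCurves.ModularForms
  Literature.NumberTheory.EllipticCurves.Rank1Residual
  Literature.NumberTheory.EllipticCurves.Rank1Residual.Typed
  Literature.NumberTheory.EllipticCurves.Wuthrich2014
  Literature.NumberTheory.EllipticCurves.SteinWuthrich2013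
  Literature.NumberTheory.EllipticCurves.Greenberg1999
  Literature.NumberTheory.EllipticCurves.GreenbergVatsal2000
  Literature.NumberTheory.EllipticCurves.CastellaGrossiSkinner2025
  Summit.BirchSwinnertonDyer.BirchSwinnertonDyer.Theorems.Rank1ResidualX1Defs
  Summit.BirchSwinnertonDyer.Rank1Residual.X1.MuLambda
  Summit.BirchSwinnertonDyer.Rank1Residual.X1.MuPart
  Summit.BirchSwinnertonDyer.Rank1Residual.X1.ParitySqueeze
  Summit.BirchSwinnertonDyer.Rank1Residual.X1.TamagawaSqueeze
  Summit.BirchSwinnertonDyer.Rank1Residual.X1.CongruenceTransfer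
  Summit.BirchSwinnertonDyer.Rank1Residual.X2.CongruentLambdaShiftMultiplicative

namespace Summit.BirchSwinnertonDyer.Rank1Residual.X2

/-! ## §1. The covered relative: Castella–Grossi–Skinner 2025 Thm. A ⇒ `MazurMainConjecture` -/

section Covered

variable (W' : WeierstrassCurve ℚ) [W'.IsElliptic] [W'.IsGloballyMinimal] (p : ℕ) [Fact p.Prime]

/-- **Castella–Grossi–Skinner 2025 Thm. A supplies the tree's `MazurMainConjecture W' p`** for a
globally minimal `E₀'/ℚ` and a prime `p > 2` of GOOD reduction with `E₀'[p]` REDUCIBLE and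
`a_p(E₀') ≢ 1 (mod p)` (non-anomalous: `¬ Anom W' p`, i.e. CGS's `φ|_{G_p} ≠ 1, ω`). The fact's
conclusion is, binder for binder, the cell's `@[conjecture] def MazurMainConjecture` (Néron
normalisation `ι g = ϖ · L_p(f, α)`): on this locus the "typed missing input" of the Eisenstein classes
is a THEOREM of the published record. [cite: CastellaGrossiSkinner2025, Theorem A (§0) = Thm. 6.0.5 (§6)] -/
theorem mazurMainConjecture_of_thmA (hA : thmA_charIdeal_eq_padicLFunction) (hp : 2 < p)
    (hgood' : W'.HasGoodReductionAtPrime p) (hred' : ¬ W'.HasIrreducibleModPGaloisRep p)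
    (hna' : ¬ (p : ℤ) ∣ W'.frobeniusTrace p - 1) : MazurMainConjecture W' p :=
  fun κ γ hκ hγ hT ↦ hA W' p hp hgood' hred' (fun h ↦ hna' h.2.2) κ γ hκ hγ hT

/-- A good reducible `p > 2` is ORDINARY (Serre 1972 Prop. 12, tree theorem
`goodOrd_of_red_of_good`): the `hord'` binder of gen 7's route-G theorems is automatic for a
covered relative. [cite: Serre1972, §1.11 Prop. 12] -/
theorem not_dvd_frobeniusTrace_of_red_of_good (hp : 2 < p) (hgood' : W'.HasGoodReductionAtPrime p)
    (hred' : ¬ W'.HasIrreducibleModPGaloisRep p) : ¬ (p : ℤ) ∣ W'.frobeniusTrace p :=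
  (goodOrd_of_red_of_good W' p hp hgood' hred').2

/-- **The covered relative's EXACT invariants `(μ_alg, λ_alg)(E₀') = (0, n')`** from CGS Thm. A and
the relative's analytic certificates `μ_an = 0`, `λ_an = n'` (gen 7's
`algebraicInvariantsEq_of_mazurMainConjecture`; Wuthrich Thm. 16 `hW16`, modularity `hpar`).
[cite: CastellaGrossiSkinner2025, Theorem A] [cite: Wuthrich2014, Thm. 16 (p. 397)] -/
theorem algebraicInvariantsEq_covered (hA : thmA_charIdeal_eq_padicLFunction)
    (hW16 : Wuthrich2014.charIdeal_dvd_padicLFunction) (hpar : nonempty_modularParametrizationData)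
    (hp : 2 < p) (hgood' : W'.HasGoodReductionAtPrime p) (hred' : ¬ W'.HasIrreducibleModPGaloisRep p)
    (hna' : ¬ (p : ℤ) ∣ W'.frobeniusTrace p - 1) {n' : ℕ} (hμ0' : X1.MuPart.AnalyticMuLE W' p 0)
    (hlam' : X1.ParitySqueeze.AnalyticLambdaEq W' p n') : AlgebraicInvariantsEq W' p n' :=
  algebraicInvariantsEq_of_mazurMainConjecture hW16 hpar W' p (by omega) hgood'
    (not_dvd_frobeniusTrace_of_red_of_good W' p hp hgood' hred') hred'
    (mazurMainConjecture_of_thmA W' p hA hp hgood' hred' hna') hμ0' hlam'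

end Covered

/-! ## §2. X2 TARGET with a COVERED relative: the transferred invariants -/

section Relative

variable {W W' : WeierstrassCurve ℚ} [W.IsElliptic] [W.IsGloballyMinimal]
  [W'.IsElliptic] [W'.IsGloballyMinimal] {p : ℕ} [Fact p.Prime]
  (S₀ : Finset (HeightOneSpectrum (𝓞 ℚ)))

/-- **X2 target, COVERED relative ⇒ `(μ_alg, λ_alg)(E₀) = (0, k)`, typed shift.** Target `(E₀, p)`:
`p ≠ 2` multiplicative, `E₀[p]` reducible, `μ_an(E₀) = 0`. Relative `(E₀', p)`: GOOD, `E₀'[p]`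
reducible, `a_p(E₀') ≢ 1 (mod p)` — Mazur's main conjecture by CGS 2025 Thm. A (`hA`) —, with
analytic certificates `μ_an = 0`, `λ_an = n'`. Congruence `E₀[p] ≅ E₀'[p]` (`TorsionIso`), shift
`CongruentLambdaShift W W' p e` (typed, per pair), `k = n' + e`. Gen 7's
`algebraicInvariantsEq_of_closedRelative_goodOrd` with its `hMC'` DISCHARGED by the published theorem.
[cite: CastellaGrossiSkinner2025, Theorem A] [cite: GreenbergVatsal2000, Thm. (1.4), §2 pp. 26–27]
[cite: Wuthrich2014, Thm. 16 (p. 397)] -/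
theorem algebraicInvariantsEq_of_coveredRelative (hA : thmA_charIdeal_eq_padicLFunction)
    (hWu : thm16_charIdeal_dvd_multiplicative_of_reducible)
    (hW16 : Wuthrich2014.charIdeal_dvd_padicLFunction)
    (hpar : nonempty_modularParametrizationData) (hp2 : p ≠ 2)
    (hmult : W.HasMultiplicativeReductionAtPrime p) (hred : ¬ W.HasIrreducibleModPGaloisRep p)
    (hμ0 : AnalyticMuLE W p 0)
    (hgood' : W'.HasGoodReductionAtPrime p) (hred' : ¬ W'.HasIrreducibleModPGaloisRep p)
    (hna' : ¬ (p : ℤ) ∣ W'.frobeniusTrace p - 1) {n' : ℕ}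
    (hμ0' : X1.MuPart.AnalyticMuLE W' p 0) (hlam' : X1.ParitySqueeze.AnalyticLambdaEq W' p n')
    (hiso : TorsionIso W W' p) {e : ℤ} (hG : CongruentLambdaShift W W' p e) {k : ℕ}
    (hk : (k : ℤ) = n' + e) : AlgebraicInvariantsEq W p k :=
  have hp : 2 < p := by
    have h2 := (Fact.out : p.Prime).two_le
    omega
  algebraicInvariantsEq_of_closedRelative_goodOrd hWu hW16 hpar hp2 hmult hred hμ0 hgood'
    (not_dvd_frobeniusTrace_of_red_of_good W' p hp hgood' hred') hred'
    (mazurMainConjecture_of_thmA W' p hA hp hgood' hred' hna') hμ0' hlam' hiso hG hk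

/-- **X2 target, COVERED relative ⇒ `(μ_alg, λ_alg)(E₀) = (0, k)`, shift DERIVED** — the same with
`CongruentLambdaShift` supplied by gen 13's
`CongruentLambdaShiftMultiplicative.congruentLambdaShift_mult_goodOrd_of_facts`, i.e. by the
PRINTED statements A40/A41 (Tate uniformisation `hT`, `hT'`), GV (5)–(7) at `p ‖ N` (`hAm`),
GV Prop. 2.5/p. 25 (`hBm`), GV p. 15 (`hF`, used at split `p` only), and for the good member GV
p. 26 (`hGV`), GV (7) (`hA7`), GV p. 8 (`hB`); `Σ₀ ∌ p` a finite set outside which both curves have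
good reduction; **`k = n' + Σ_{v∈Σ₀}(δ_{E₀'}^{(v)} − δ_{E₀}^{(v)}) − e_p(E₀)`** (`e_p = 1` at a split,
`0` at a non-split `p`). [cite: CastellaGrossiSkinner2025, Theorem A]
[cite: GreenbergVatsal2000, Thm. (1.4), §1 (5)–(7), pp. 14–15, §2 pp. 20–27]
[cite: Wuthrich2014, Thm. 16 (p. 397)] -/
theorem algebraicInvariantsEq_of_coveredRelative_of_facts (hA : thmA_charIdeal_eq_padicLFunction)
    (hWu : thm16_charIdeal_dvd_multiplicative_of_reducible)
    (hW16 : Wuthrich2014.charIdeal_dvd_padicLFunction)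
    (hpar : nonempty_modularParametrizationData)
    (hT : Silverman1994_thmV53_corV54_tateUniformisation.{0})
    (hT' : Silverman1994_thmV53_tateUniformisation.{0})
    (hAm : lambda_nonPrimitive_eq_add_sum_delta_multiplicative)
    (hBm : datumSelmer_divisible_of_finite_torsionBy) (hF : datumStrictSelmer_lt_datumSelmer_of_split)
    (hGV : imKummer_ge_greenbergCondition_at_p) (hA7 : lambda_nonPrimitive_eq_add_sum_delta)
    (hB : divisible_nonPrimitiveSelmerInfty_of_mu_eq_zero) (hp2 : p ≠ 2)
    (hmult : W.HasMultiplicativeReductionAtPrime p) (hred : ¬ W.HasIrreducibleModPGaloisRep p)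
    (hμ0 : AnalyticMuLE W p 0)
    (hgood' : W'.HasGoodReductionAtPrime p) (hred' : ¬ W'.HasIrreducibleModPGaloisRep p)
    (hna' : ¬ (p : ℤ) ∣ W'.frobeniusTrace p - 1) {n' : ℕ}
    (hμ0' : X1.MuPart.AnalyticMuLE W' p 0) (hlam' : X1.ParitySqueeze.AnalyticLambdaEq W' p n')
    (hS₀ : ∀ v ∈ S₀, ((p : ℕ) : 𝓞 ℚ) ∉ v.asIdeal)
    (hS : ∀ v : HeightOneSpectrum (𝓞 ℚ), v ∉ S₀ → ((p : ℕ) : 𝓞 ℚ) ∉ v.asIdeal →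
      W.HasGoodReductionAt v)
    (hS' : ∀ v : HeightOneSpectrum (𝓞 ℚ), v ∉ S₀ → ((p : ℕ) : 𝓞 ℚ) ∉ v.asIdeal →
      W'.HasGoodReductionAt v)
    (hiso : TorsionIso W W' p) {k : ℕ}
    (hk : (k : ℤ) = n' + (∑ v ∈ S₀, ((delta W' p v : ℤ) - (delta W p v : ℤ)) -
      (if W.HasSplitMultiplicativeReductionAtPrime p then 1 else 0))) :
    AlgebraicInvariantsEq W p k :=
  have hp : 2 < p := by
    have h2 := (Fact.out : p.Prime).two_le
    omega
  algebraicInvariantsEq_of_coveredRelative hA hWu hW16 hpar hp2 hmult hred hμ0 hgood' hred' hna' hμ0'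
    hlam' hiso
    (CongruentLambdaShiftMultiplicative.congruentLambdaShift_mult_goodOrd_of_facts W W' S₀ hT hT' hAm
      hBm hF hGV hA7 hB hp2 hmult hgood' (not_dvd_frobeniusTrace_of_red_of_good W' p hp hgood' hred')
      hS₀ hS hS')
    hk

end Relative

/-! ## §3. Headlines: Mazur's main conjecture and `BSD(E₀, p)` at the X2 pair -/

section Headlines

variable {W W' : WeierstrassCurve ℚ} [W.IsElliptic] [W.IsGloballyMinimal]
  [W'.IsElliptic] [W'.IsGloballyMinimal] {p : ℕ} [Fact p.Prime]
  (S₀ : Finset (HeightOneSpectrum (𝓞 ℚ)))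

/-- **Mazur's main conjecture at the X2 pair from a COVERED relative (both ranks), typed shift**:
target `μ_an(E₀) = 0`, `λ_an(E₀) = n` (trivial zero included); covered relative as in §2;
`k = n' + e` and `n ≤ k` at a non-split / `n ≤ k + 1` at a split `p` (the squeeze
`mazurMainConjectureAt_of_algebraicInvariantsEq`: Kato–Wuthrich gives `≥`). At an X2b pair this is
its typed input `MissingInputB W p` (`= X2.MazurMainConjectureAt W p` by `rfl`); at an X2c pair the
CYCLOTOMIC main conjecture (BSD there needs the regulator valuation, `X2/RankOneRegulatorBSD.lean`).
[cite: CastellaGrossiSkinner2025, Theorem A] [cite: GreenbergVatsal2000, Thm. (1.4), §2 pp. 26–27]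
[cite: Wuthrich2014, Thm. 16 (p. 397)] -/
theorem mazurMainConjectureAt_of_coveredRelative (hA : thmA_charIdeal_eq_padicLFunction)
    (hWu : thm16_charIdeal_dvd_multiplicative_of_reducible)
    (hW16 : Wuthrich2014.charIdeal_dvd_padicLFunction)
    (hpar : nonempty_modularParametrizationData) (hp2 : p ≠ 2)
    (hmult : W.HasMultiplicativeReductionAtPrime p) (hred : ¬ W.HasIrreducibleModPGaloisRep p) {n : ℕ}
    (hμ0 : AnalyticMuLE W p 0) (hlam : AnalyticLambdaEq W p n)
    (hgood' : W'.HasGoodReductionAtPrime p) (hred' : ¬ W'.HasIrreducibleModPGaloisRep p)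
    (hna' : ¬ (p : ℤ) ∣ W'.frobeniusTrace p - 1) {n' : ℕ}
    (hμ0' : X1.MuPart.AnalyticMuLE W' p 0) (hlam' : X1.ParitySqueeze.AnalyticLambdaEq W' p n')
    (hiso : TorsionIso W W' p) {e : ℤ} (hG : CongruentLambdaShift W W' p e) {k : ℕ}
    (hk : (k : ℤ) = n' + e)
    (hkN : ¬ W.HasSplitMultiplicativeReductionAtPrime p → n ≤ k)
    (hkS : W.HasSplitMultiplicativeReductionAtPrime p → n ≤ k + 1) : X2.MazurMainConjectureAt W p :=
  mazurMainConjectureAt_of_algebraicInvariantsEq hWu W p hp2 hmult hred hμ0 hlam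
    (algebraicInvariantsEq_of_coveredRelative hA hWu hW16 hpar hp2 hmult hred hμ0 hgood' hred' hna'
      hμ0' hlam' hiso hG hk) hkN hkS

/-- **Mazur's main conjecture at the X2 pair from a COVERED relative, shift DERIVED** (printed
statements + certificates only): `k = n' + Σ_{v∈Σ₀}(δ' − δ) − e_p(E₀)`, `n ≤ k` (non-split) /
`n ≤ k + 1` (split). [cite: CastellaGrossiSkinner2025, Theorem A]
[cite: GreenbergVatsal2000, Thm. (1.4), §1 (5)–(7), pp. 14–15, §2 pp. 20–27]
[cite: Wuthrich2014, Thm. 16 (p. 397)] -/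
theorem mazurMainConjectureAt_of_coveredRelative_of_facts (hA : thmA_charIdeal_eq_padicLFunction)
    (hWu : thm16_charIdeal_dvd_multiplicative_of_reducible)
    (hW16 : Wuthrich2014.charIdeal_dvd_padicLFunction)
    (hpar : nonempty_modularParametrizationData)
    (hT : Silverman1994_thmV53_corV54_tateUniformisation.{0})
    (hT' : Silverman1994_thmV53_tateUniformisation.{0})
    (hAm : lambda_nonPrimitive_eq_add_sum_delta_multiplicative)
    (hBm : datumSelmer_divisible_of_finite_torsionBy) (hF : datumStrictSelmer_lt_datumSelmer_of_split)
    (hGV : imKummer_ge_greenbergCondition_at_p) (hA7 : lambda_nonPrimitive_eq_add_sum_delta)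
    (hB : divisible_nonPrimitiveSelmerInfty_of_mu_eq_zero) (hp2 : p ≠ 2)
    (hmult : W.HasMultiplicativeReductionAtPrime p) (hred : ¬ W.HasIrreducibleModPGaloisRep p) {n : ℕ}
    (hμ0 : AnalyticMuLE W p 0) (hlam : AnalyticLambdaEq W p n)
    (hgood' : W'.HasGoodReductionAtPrime p) (hred' : ¬ W'.HasIrreducibleModPGaloisRep p)
    (hna' : ¬ (p : ℤ) ∣ W'.frobeniusTrace p - 1) {n' : ℕ}
    (hμ0' : X1.MuPart.AnalyticMuLE W' p 0) (hlam' : X1.ParitySqueeze.AnalyticLambdaEq W' p n')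
    (hS₀ : ∀ v ∈ S₀, ((p : ℕ) : 𝓞 ℚ) ∉ v.asIdeal)
    (hS : ∀ v : HeightOneSpectrum (𝓞 ℚ), v ∉ S₀ → ((p : ℕ) : 𝓞 ℚ) ∉ v.asIdeal →
      W.HasGoodReductionAt v)
    (hS' : ∀ v : HeightOneSpectrum (𝓞 ℚ), v ∉ S₀ → ((p : ℕ) : 𝓞 ℚ) ∉ v.asIdeal →
      W'.HasGoodReductionAt v)
    (hiso : TorsionIso W W' p) {k : ℕ}
    (hk : (k : ℤ) = n' + (∑ v ∈ S₀, ((delta W' p v : ℤ) - (delta W p v : ℤ)) -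
      (if W.HasSplitMultiplicativeReductionAtPrime p then 1 else 0)))
    (hkN : ¬ W.HasSplitMultiplicativeReductionAtPrime p → n ≤ k)
    (hkS : W.HasSplitMultiplicativeReductionAtPrime p → n ≤ k + 1) : X2.MazurMainConjectureAt W p :=
  mazurMainConjectureAt_of_algebraicInvariantsEq hWu W p hp2 hmult hred hμ0 hlam
    (algebraicInvariantsEq_of_coveredRelative_of_facts S₀ hA hWu hW16 hpar hT hT' hAm hBm hF hGV hA7 hB
      hp2 hmult hred hμ0 hgood' hred' hna' hμ0' hlam' hS₀ hS hS' hiso hk) hkN hkS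

/-- **HEADLINE (rank `0`, COVERED relative, typed shift): `BSD(E₀, p)`** at an odd multiplicative
Eisenstein prime of analytic rank `0` — gen 7's `bsdp_of_closedRelative_goodOrd_rankZero` with the
relative's main conjecture DISCHARGED by CGS 2025 Thm. A (Stein–Wuthrich Thm. 6.1, Greenberg–Stevens,
GZK, modularity for the last step). [cite: CastellaGrossiSkinner2025, Theorem A]
[cite: GreenbergVatsal2000, Thm. (1.4), §2 pp. 26–27] [cite: Wuthrich2014, Thm. 16 (p. 397)]
[cite: SteinWuthrich2013, Thm. 6.1 (p. 20)] -/
theorem bsdp_of_coveredRelative_rankZero (hA : thmA_charIdeal_eq_padicLFunction)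
    (hWu : thm16_charIdeal_dvd_multiplicative_of_reducible)
    (hW16 : Wuthrich2014.charIdeal_dvd_padicLFunction)
    (hJs : thm61_splitMultiplicative) (hJn : thm61_nonsplitMultiplicative)
    (hHs : exists_isSplitMultCanonical) (hHn : exists_isMultCanonical)
    (hGZK : rank_eq_analyticRank_of_analyticRank_le_one) (hmod : hasEntireLFunction_rat)
    (hpar : nonempty_modularParametrizationData)
    (W W' : WeierstrassCurve ℚ) [W.IsElliptic] [W.IsGloballyMinimal] [W'.IsElliptic]
    [W'.IsGloballyMinimal] (p : ℕ) [Fact p.Prime] (hGS : greenberg_stevens (W := W) (p := p))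
    (hp2 : p ≠ 2) (hmult : W.HasMultiplicativeReductionAtPrime p)
    (hred : ¬ W.HasIrreducibleModPGaloisRep p) (hr : W.analyticRank = 0) {n : ℕ}
    (hμ0 : AnalyticMuLE W p 0) (hlam : AnalyticLambdaEq W p n)
    (hgood' : W'.HasGoodReductionAtPrime p) (hred' : ¬ W'.HasIrreducibleModPGaloisRep p)
    (hna' : ¬ (p : ℤ) ∣ W'.frobeniusTrace p - 1) {n' : ℕ}
    (hμ0' : X1.MuPart.AnalyticMuLE W' p 0) (hlam' : X1.ParitySqueeze.AnalyticLambdaEq W' p n')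
    (hiso : TorsionIso W W' p) {e : ℤ} (hG : CongruentLambdaShift W W' p e) {k : ℕ}
    (hk : (k : ℤ) = n' + e)
    (hkN : ¬ W.HasSplitMultiplicativeReductionAtPrime p → n ≤ k)
    (hkS : W.HasSplitMultiplicativeReductionAtPrime p → n ≤ k + 1) : BSDp W p :=
  have hp : 2 < p := by
    have h2 := (Fact.out : p.Prime).two_le
    omega
  bsdp_of_closedRelative_goodOrd_rankZero hWu hW16 hJs hJn hHs hHn hGZK hmod hpar W W' p hGS hp2 hmult
    hred hr hμ0 hlam hgood' (not_dvd_frobeniusTrace_of_red_of_good W' p hp hgood' hred') hred'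
    (mazurMainConjecture_of_thmA W' p hA hp hgood' hred' hna') hμ0' hlam' hiso hG hk hkN hkS

/-- **HEADLINE (rank `0`, COVERED relative, shift DERIVED): `BSD(E₀, p)`** — printed statements +
certificates only; `k = n' + Σ_{v∈Σ₀}(δ' − δ) − e_p(E₀)`.
[cite: CastellaGrossiSkinner2025, Theorem A]
[cite: GreenbergVatsal2000, Thm. (1.4), §1 (5)–(7), pp. 14–15, §2 pp. 20–27]
[cite: Wuthrich2014, Thm. 16 (p. 397)] [cite: SteinWuthrich2013, Thm. 6.1 (p. 20)] -/
theorem bsdp_of_coveredRelative_rankZero_of_facts (hA : thmA_charIdeal_eq_padicLFunction)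
    (hWu : thm16_charIdeal_dvd_multiplicative_of_reducible)
    (hW16 : Wuthrich2014.charIdeal_dvd_padicLFunction)
    (hJs : thm61_splitMultiplicative) (hJn : thm61_nonsplitMultiplicative)
    (hHs : exists_isSplitMultCanonical) (hHn : exists_isMultCanonical)
    (hGZK : rank_eq_analyticRank_of_analyticRank_le_one) (hmod : hasEntireLFunction_rat)
    (hpar : nonempty_modularParametrizationData)
    (hT : Silverman1994_thmV53_corV54_tateUniformisation.{0})
    (hT' : Silverman1994_thmV53_tateUniformisation.{0})
    (hAm : lambda_nonPrimitive_eq_add_sum_delta_multiplicative)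
    (hBm : datumSelmer_divisible_of_finite_torsionBy) (hF : datumStrictSelmer_lt_datumSelmer_of_split)
    (hGV : imKummer_ge_greenbergCondition_at_p) (hA7 : lambda_nonPrimitive_eq_add_sum_delta)
    (hB : divisible_nonPrimitiveSelmerInfty_of_mu_eq_zero)
    (W W' : WeierstrassCurve ℚ) [W.IsElliptic] [W.IsGloballyMinimal] [W'.IsElliptic]
    [W'.IsGloballyMinimal] (p : ℕ) [Fact p.Prime] (hGS : greenberg_stevens (W := W) (p := p))
    (hp2 : p ≠ 2) (hmult : W.HasMultiplicativeReductionAtPrime p)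
    (hred : ¬ W.HasIrreducibleModPGaloisRep p) (hr : W.analyticRank = 0) {n : ℕ}
    (hμ0 : AnalyticMuLE W p 0) (hlam : AnalyticLambdaEq W p n)
    (hgood' : W'.HasGoodReductionAtPrime p) (hred' : ¬ W'.HasIrreducibleModPGaloisRep p)
    (hna' : ¬ (p : ℤ) ∣ W'.frobeniusTrace p - 1) {n' : ℕ}
    (hμ0' : X1.MuPart.AnalyticMuLE W' p 0) (hlam' : X1.ParitySqueeze.AnalyticLambdaEq W' p n')
    (hS₀ : ∀ v ∈ S₀, ((p : ℕ) : 𝓞 ℚ) ∉ v.asIdeal)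
    (hS : ∀ v : HeightOneSpectrum (𝓞 ℚ), v ∉ S₀ → ((p : ℕ) : 𝓞 ℚ) ∉ v.asIdeal →
      W.HasGoodReductionAt v)
    (hS' : ∀ v : HeightOneSpectrum (𝓞 ℚ), v ∉ S₀ → ((p : ℕ) : 𝓞 ℚ) ∉ v.asIdeal →
      W'.HasGoodReductionAt v)
    (hiso : TorsionIso W W' p) {k : ℕ}
    (hk : (k : ℤ) = n' + (∑ v ∈ S₀, ((delta W' p v : ℤ) - (delta W p v : ℤ)) -
      (if W.HasSplitMultiplicativeReductionAtPrime p then 1 else 0)))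
    (hkN : ¬ W.HasSplitMultiplicativeReductionAtPrime p → n ≤ k)
    (hkS : W.HasSplitMultiplicativeReductionAtPrime p → n ≤ k + 1) : BSDp W p :=
  bsdp_of_algebraicInvariantsEq_rankZero hWu hJs hJn hHs hHn hGZK hmod hpar W p hGS hp2 hmult hred hr
    hμ0 hlam (algebraicInvariantsEq_of_coveredRelative_of_facts S₀ hA hWu hW16 hpar hT hT' hAm hBm hF
      hGV hA7 hB hp2 hmult hred hμ0 hgood' hred' hna' hμ0' hlam' hS₀ hS hS' hiso hk) hkN hkS

end Headlines

end Summit.BirchSwinnertonDyer.Rank1Residual.X2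

end
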